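import Summits.Schanuel.Schanuel.Theorems.RootDecomp1BFinitePinningFloor01

/-!
# `RootDecomp1BFinitePinningFloor` — part 02 of 04 (`RootDecomp1BFinitePinningFloor02`): §3 (continued) non-measurability of every shear (`not_measurable_E_ofReal`), the verdicts `¬ S_E(2)` at `(iπ, π^k)` and `¬ X_E(2)` at `(π, π^k)` for pinned shears with `u = π^k`, `ℓ = log p` (`not_schanuelRankE_two_of`, `not_kleinPolarE_of`, `kleinPolar_pi_cell_of`); §4 the EXPLICIT MODEL `E₂` (shear `π² ↦ log 2`: `exists_phi_piSq`, `S₂`, `E₂`, `E₂_piSq`, `not_schanuelRankE_E₂_two`, `not_kleinPolarE_E₂`, `periodPackage_E₂`)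

Part 2 of the port of the lens-4 gen-23 kernel `FinitePinningFloor.lean` (see part 01 for the overview, the construction of pinned shears and the reading for the crux). PORT in four parts (≤ 400 lines each, shared namespace `Summit.Schanuel.Schanuel.Theorems.RootDecomp1BFinitePinningFloor`, each part importing the previous; `--supports stmt-Schanuel-24622`) of the decomp-schanuel lens-4 kernel file `HOME/decomp-schanuel-lens-4/g23/FinitePinningFloor.lean` (gen 23, 2026-08-30, sha256 d4bafcab9e6edb89…; `lean check` rc 0 · 0 sorry · standard axioms). 
-/

noncomputable section

open Complex

namespace Summit.Schanuel.Schanuel.Theorems.RootDecomp1BFinitePinningFloor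

open Summit.Schanuel.Schanuel.Theorems.RootDecomp1BTranscendencePackageFloor
open Summit.Schanuel.Schanuel.Theorems.RootDecomp1BPeriodKernelFloor
open Literature.NumberTheory.Transcendental (nesterenko baker_holds SchanuelRank transcendental_pi_holds)

/-! ## §1 Helpers (part-local copies of the private helpers of the kernel file) -/

/-- An element of an intermediate field `K` is algebraic over `K`. [folklore] -/
private theorem alg_of_mem {K : IntermediateField ℚ ℂ} {x : ℂ} (hx : x ∈ K) : IsAlgebraic K x :=
  isAlgebraic_algebraMap (⟨x, hx⟩ : K)

/-- A natural number is algebraic. [folklore] -/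
private theorem alg_natCast (p : ℕ) : IsAlgebraic ℚ (p : ℂ) := isAlgebraic_nat p

/-- `-1` is algebraic. [folklore] -/
private theorem alg_neg_one : IsAlgebraic ℚ (-1 : ℂ) := by
  have h : IsAlgebraic ℚ ((-1 : ℤ) : ℂ) := isAlgebraic_int (-1)
  simpa using h

/-- `i` is algebraic. [folklore] -/
private theorem alg_I : IsAlgebraic ℚ I := mem_Qb_iff.mp I_mem_Qb

/-! ## §3 (continued) PINNED SHEARS — measurability and the verdicts -/

section Pinned

variable (S : Shear)

/-! ### No shear with `d ≠ 0` is Borel-measurable on the real axis -/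

/-- On the real axis `Re (S.E x) = e^{x + φ(x)d}`. [folklore] -/
theorem re_E_ofReal (x : ℝ) : (S.E x).re = Real.exp (x + S.φR x * S.d) := by
  rw [S.E_apply, S.θ_ofReal, ← Complex.ofReal_exp, Complex.ofReal_re]

/-- **A sheared exponential (`d ≠ 0`) is NOT BOREL-MEASURABLE on the real axis**: otherwise the
additive map `x ↦ φ(x)·d = log Re E(x) - x` would be measurable, hence continuous (Banach–Steinhaus
automatic continuity: Mathlib's `AddMonoidHom.exists_nhds_isBounded` (Steinhaus) and
`AddMonoidHom.continuous_of_isBounded_nhds_zero`), hence `ℝ`-linear; as it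
vanishes at `1` it would vanish at `u`, where it equals `d`. So the floor's models evade every
REGULARITY channel only by being non-measurable. [folklore] -/
theorem not_measurable_E_ofReal (hd : S.d ≠ 0) : ¬ Measurable fun x : ℝ => S.E x := by
  intro hm
  let ψ : ℝ →+ ℝ :=
    { toFun := fun x => S.φR x * S.d
      map_zero' := by simp only [S.φR_zero, zero_mul]
      map_add' := fun x y => by simp only [S.φR_add, add_mul] }
  have hψ_eq : (ψ : ℝ → ℝ) = fun x : ℝ => Real.log ((S.E (x : ℂ)).re) - x := by
    funext x
    show S.φR x * S.d = Real.log ((S.E x).re) - x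
    rw [re_E_ofReal, Real.log_exp]
    ring
  have hψm : Measurable (ψ : ℝ → ℝ) := by
    rw [hψ_eq]
    exact (Real.measurable_log.comp (Complex.measurable_re.comp hm)).sub measurable_id
  have hψc : Continuous (ψ : ℝ → ℝ) := by
    obtain ⟨s, hs, hbdd⟩ := ψ.exists_nhds_isBounded hψm 0
    exact ψ.continuous_of_isBounded_nhds_zero hs hbdd
  have h1 : ψ 1 = 0 := by
    show S.φR 1 * S.d = 0
    rw [S.φR_one, zero_mul]
  have hu : ψ S.u = 0 := by
    have h := map_real_smul ψ hψc S.u 1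
    rw [smul_eq_mul, mul_one, smul_eq_mul, h1, mul_zero] at h
    exact h
  apply hd
  have h' : S.φR S.u * S.d = 0 := hu
  rwa [S.φR_u, one_mul] at h'

/-- … hence not measurable on `ℂ` either. [folklore] -/
theorem not_measurable_E (hd : S.d ≠ 0) : ¬ Measurable S.E := fun hm =>
  not_measurable_E_ofReal S hd (hm.comp Complex.measurable_ofReal)

/-! ### The verdict `¬ S_E(2)` at `(iπ, π^k)` over `ℚ(π)` -/

/-- `ℚ(π)`, `trdeg ≤ 1`. [folklore] -/
def Kπ : IntermediateField ℚ ℂ := IntermediateField.adjoin ℚ (Set.range ![(Real.pi : ℂ)])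

/-- `trdeg_ℚ ℚ(π) ≤ 1` (one generator). [folklore] -/
theorem trdeg_Kπ_le : Algebra.trdeg ℚ Kπ ≤ ((1 : ℕ) : Cardinal) := by
  refine (RootDecomp1BTameFlagCore.trdeg_adjoin_le_cardinalMk _).trans ?_
  refine Cardinal.mk_range_le.trans ?_
  simp

/-- `π ∈ ℚ(π)`. [folklore] -/
theorem pi_mem_Kπ : (Real.pi : ℂ) ∈ Kπ := IntermediateField.subset_adjoin ℚ _ ⟨0, rfl⟩

/-- For a pinned shear with `u = π^k`, `ℓ = log p`: the pair `(iπ, π^k)` and its `E`-values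
`(-1, p)` are algebraic over `ℚ(π)`. [folklore] -/
theorem pair_algebraic_of {k p : ℕ} (hp : 0 < p) (h : S.φ Real.pi = 0) (hu : S.u = Real.pi ^ k)
    (hℓ : S.ℓ = Real.log p) :
    ∀ x ∈ Set.range ![(Real.pi : ℂ) * I, (Real.pi : ℂ) ^ k] ∪
      Set.range (S.E ∘ ![(Real.pi : ℂ) * I, (Real.pi : ℂ) ^ k]), IsAlgebraic Kπ x := by
  have aI : IsAlgebraic Kπ I := alg_I.tower_top (L := Kπ)
  have aπ : IsAlgebraic Kπ (Real.pi : ℂ) := alg_of_mem pi_mem_Kπ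
  have hEu : S.E ((Real.pi : ℂ) ^ k) = (p : ℂ) := by
    rw [← Complex.ofReal_pow, ← hu]
    exact E_u_of_log S hp hℓ
  have hEπI := E_pi_mul_I_of S h
  rintro x (⟨j, rfl⟩ | ⟨j, rfl⟩) <;> fin_cases j
  · simpa using aπ.mul aI
  · simpa using aπ.pow k
  · simpa [hEπI] using alg_neg_one.tower_top (L := Kπ)
  · simpa [hEu] using (alg_natCast p).tower_top (L := Kπ)

/-- **`S_E(2)` FAILS** for a pinned shear with `u = π^k`, `ℓ = log p`, at the `ℚ`-free,
conjugation-stable pair `(iπ, π^k)`: `trdeg ℚ(iπ, π^k, -1, p) = 1 < 2`. [folklore] -/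
theorem not_schanuelRankE_two_of {k p : ℕ} (hp : 0 < p) (h : S.φ Real.pi = 0)
    (hu : S.u = Real.pi ^ k) (hℓ : S.ℓ = Real.log p) : ¬ SchanuelRankE S.E 2 := by
  intro hS
  have h1 := (hS _ (linearIndependent_piI_pow k)).trans
    ((RootDecomp1EAnchor.trdeg_adjoin_le_of_isAlgebraic (pair_algebraic_of S hp h hu hℓ)).trans
      trdeg_Kπ_le)
  have h2 : (2 : ℕ) ≤ 1 := by exact_mod_cast h1
  omega

/-- … hence the summit text fails for it. [folklore] -/
theorem not_schanuelE_of {k p : ℕ} (hp : 0 < p) (h : S.φ Real.pi = 0)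
    (hu : S.u = Real.pi ^ k) (hℓ : S.ℓ = Real.log p) : ¬ SchanuelE S.E :=
  fun hS => not_schanuelRankE_two_of S hp h hu hℓ (hS 2)

/-! ### The verdict `¬ X_E(2)` at `r = (π, π^k)` over `ℚ(π, e^π, p^i)` -/

/-- `K(p) = ℚ(π, e^π, p^i)` with `p^i := e^{i log p}`, `trdeg ≤ 3`. [folklore] -/
def Kp (p : ℕ) : IntermediateField ℚ ℂ :=
  IntermediateField.adjoin ℚ
    (Set.range ![(Real.pi : ℂ), cexp Real.pi, cexp (((Real.log p : ℝ) : ℂ) * I)])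

/-- `trdeg_ℚ K(p) ≤ 3` (three generators). [folklore] -/
theorem trdeg_Kp_le (p : ℕ) : Algebra.trdeg ℚ (Kp p) ≤ ((3 : ℕ) : Cardinal) := by
  refine (RootDecomp1BTameFlagCore.trdeg_adjoin_le_cardinalMk _).trans ?_
  refine Cardinal.mk_range_le.trans ?_
  simp

/-- `π ∈ K(p)`. [folklore] -/
theorem pi_mem_Kp (p : ℕ) : (Real.pi : ℂ) ∈ Kp p := IntermediateField.subset_adjoin ℚ _ ⟨0, rfl⟩

/-- `e^π ∈ K(p)`. [folklore] -/
theorem expPi_mem_Kp (p : ℕ) : cexp Real.pi ∈ Kp p := IntermediateField.subset_adjoin ℚ _ ⟨1, rfl⟩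

/-- `p^i ∈ K(p)`. [folklore] -/
theorem unit_mem_Kp (p : ℕ) : cexp (((Real.log p : ℝ) : ℂ) * I) ∈ Kp p :=
  IntermediateField.subset_adjoin ℚ _ ⟨2, rfl⟩

/-- For a pinned shear with `u = π^k`, `ℓ = log p`: the polar generating set of `r = (π, π^k)` —
`π, π^k, iπ, iπ^k` — and its `E`-values `e^π, p, -1, p^i` are algebraic over `K(p)`. [folklore] -/
theorem polar_algebraic_of {k p : ℕ} (hp : 0 < p) (h : S.φ Real.pi = 0) (hu : S.u = Real.pi ^ k)
    (hℓ : S.ℓ = Real.log p) :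
    ∀ x ∈ Set.range (Fin.append (fun j => (((![Real.pi, Real.pi ^ k] : Fin 2 → ℝ) j : ℝ) : ℂ))
        (fun j => (((![Real.pi, Real.pi ^ k] : Fin 2 → ℝ) j : ℝ) : ℂ) * Complex.I)) ∪
      Set.range (S.E ∘ Fin.append (fun j => (((![Real.pi, Real.pi ^ k] : Fin 2 → ℝ) j : ℝ) : ℂ))
        (fun j => (((![Real.pi, Real.pi ^ k] : Fin 2 → ℝ) j : ℝ) : ℂ) * Complex.I)),
      IsAlgebraic (Kp p) x := by
  have aI : IsAlgebraic (Kp p) I := alg_I.tower_top (L := Kp p)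
  have aπ : IsAlgebraic (Kp p) (Real.pi : ℂ) := alg_of_mem (pi_mem_Kp p)
  have ae : IsAlgebraic (Kp p) (cexp Real.pi) := alg_of_mem (expPi_mem_Kp p)
  have aw : IsAlgebraic (Kp p) (cexp (((Real.log p : ℝ) : ℂ) * I)) := alg_of_mem (unit_mem_Kp p)
  have hEπ : S.E (Real.pi : ℂ) = cexp Real.pi := E_pi_of S h
  have hEπI : S.E ((Real.pi : ℂ) * I) = -1 := E_pi_mul_I_of S h
  have hEu : S.E ((Real.pi : ℂ) ^ k) = (p : ℂ) := by
    rw [← Complex.ofReal_pow, ← hu]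
    exact E_u_of_log S hp hℓ
  have hEuI : S.E ((Real.pi : ℂ) ^ k * I) = cexp (((Real.log p : ℝ) : ℂ) * I) := by
    rw [← Complex.ofReal_pow, ← hu, ← hℓ]
    exact E_u_mul_I S
  rintro x (⟨i, rfl⟩ | ⟨i, rfl⟩)
  · refine Fin.addCases (fun j => ?_) (fun j => ?_) i
    · rw [Fin.append_left]
      fin_cases j
      · simpa using aπ
      · simpa using aπ.pow k
    · rw [Fin.append_right]
      fin_cases j
      · simpa using aπ.mul aI
      · simpa using (aπ.pow k).mul aI
  · refine Fin.addCases (fun j => ?_) (fun j => ?_) i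
    · simp only [Function.comp_apply]
      rw [Fin.append_left]
      fin_cases j
      · simpa [hEπ] using ae
      · simpa [hEu] using (alg_natCast p).tower_top (L := Kp p)
    · simp only [Function.comp_apply]
      rw [Fin.append_right]
      fin_cases j
      · simpa [hEπI] using alg_neg_one.tower_top (L := Kp p)
      · simpa [hEuI] using aw

/-- **`X_E(2)` FAILS** for a pinned shear with `u = π^k` (`k ≠ 1`), `ℓ = log p`, at the `ℚ`-free
real pair `r = (π, π^k)`: the eight generators are algebraic over `ℚ(π, e^π, p^i)`, `trdeg ≤ 3 < 4`.
[folklore] -/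
theorem not_kleinPolarE_of {k p : ℕ} (hk : k ≠ 1) (hp : 0 < p) (h : S.φ Real.pi = 0)
    (hu : S.u = Real.pi ^ k) (hℓ : S.ℓ = Real.log p) : ¬ KleinPolarE S.E := by
  intro hX
  have h1 := (hX 2 ![Real.pi, Real.pi ^ k] (linearIndependent_pi_pow hk)).trans
    ((RootDecomp1EAnchor.trdeg_adjoin_le_of_isAlgebraic (polar_algebraic_of S hp h hu hℓ)).trans
      (trdeg_Kp_le p))
  have h2 : (2 + 2 : ℕ) ≤ 3 := by exact_mod_cast h1
  omega

/-- … whereas the LENGTH-ONE Klein-polar cell at `r = (π)` HOLDS for every pinned shear: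
`trdeg ℚ(π, iπ, E π, E(iπ)) = trdeg ℚ(π, e^π) = 2` (Nesterenko). [cite: Nesterenko1996SbMath, Theorem 1 and its corollaries] -/
theorem kleinPolar_pi_cell_of (hN : nesterenko) (h : S.φ Real.pi = 0) : ((1 + 1 : ℕ) : Cardinal) ≤ Algebra.trdeg ℚ ↥(IntermediateField.adjoin ℚ (Set.range (Fin.append (fun j => (((![Real.pi] : Fin 1 → ℝ) j : ℝ) : ℂ)) (fun j => (((![Real.pi] : Fin 1 → ℝ) j : ℝ) : ℂ) * Complex.I)) ∪ Set.range (S.E ∘ Fin.append (fun j => (((![Real.pi] : Fin 1 → ℝ) j : ℝ) : ℂ)) (fun j => (((![Real.pi] : Fin 1 → ℝ) j : ℝ) : ℂ) * Complex.I)))) := by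
  set L := IntermediateField.adjoin ℚ (Set.range (Fin.append (fun j => (((![Real.pi] : Fin 1 → ℝ) j : ℝ) : ℂ)) (fun j => (((![Real.pi] : Fin 1 → ℝ) j : ℝ) : ℂ) * Complex.I)) ∪ Set.range (S.E ∘ Fin.append (fun j => (((![Real.pi] : Fin 1 → ℝ) j : ℝ) : ℂ)) (fun j => (((![Real.pi] : Fin 1 → ℝ) j : ℝ) : ℂ) * Complex.I))) with hL
  have hπ : (Real.pi : ℂ) ∈ L := by
    refine IntermediateField.subset_adjoin ℚ _ (Set.mem_union_left _ ⟨Fin.castAdd 1 0, ?_⟩)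
    rw [Fin.append_left]
    rfl
  have hE : cexp Real.pi ∈ L := by
    refine IntermediateField.subset_adjoin ℚ _ (Set.mem_union_right _ ⟨Fin.castAdd 1 0, ?_⟩)
    rw [Function.comp_apply, Fin.append_left, ← E_pi_of S h]
    rfl
  have hx : AlgebraicIndependent ℚ ![(⟨Real.pi, hπ⟩ : L), ⟨cexp Real.pi, hE⟩] := by
    refine AlgebraicIndependent.of_comp L.val ?_
    convert algebraicIndependent_pi_expPi_complex hN using 1
    funext i; fin_cases i <;> rfl
  have h := hx.cardinalMk_le_trdeg
  rw [Cardinal.mk_fin] at h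
  exact h

end Pinned

/-! ## §4 The EXPLICIT MODEL `E₂`: the shear `π² ↦ log 2` fixing `ℚ̄ ⊕ ℚ̄π` (no hypothesis needed
for the construction; Nesterenko enters only through (P3)) -/

/-- The shear functional of the model `E₂` exists: an `A`-linear `φ : ℝ → A` with `φ 1 = 0`,
`φ (π²) = 1`, `φ (log 2) ≠ 0` and `φ π = 0` (transcendence of `π` gives the `A`-independence of
`1, π, π²`; Baker the non-degeneracy in the dependent case). [folklore] -/
theorem exists_phi_piSq :
    ∃ φ : ℝ →ₗ[A] A, φ 1 = 0 ∧ φ (Real.pi ^ 2) = 1 ∧ φ ℓ₀ ≠ 0 ∧ φ Real.pi = 0 := by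
  have hli3 := linearIndependent_one_pi_piSq
  by_cases hmem : ℓ₀ ∈ Submodule.span A (Set.range ![(1 : ℝ), Real.pi, Real.pi ^ 2])
  · obtain ⟨φ, hφ⟩ := exists_functional hli3 ![0, 0, 1]
    have h0 : φ 1 = 0 := by simpa using hφ 0
    have hπ : φ Real.pi = 0 := by simpa using hφ 1
    have h1 : φ (Real.pi ^ 2) = 1 := by simpa using hφ 2
    refine ⟨φ, h0, h1, ?_, hπ⟩
    rw [Submodule.mem_span_range_iff_exists_fun] at hmem
    obtain ⟨cf, hcf⟩ := hmem
    rw [Fin.sum_univ_three] at hcf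
    simp only [Matrix.cons_val_zero, Matrix.cons_val_one, Matrix.cons_val] at hcf
    have hφℓ : φ ℓ₀ = cf 2 := by
      rw [← hcf, map_add, map_add, map_smul, map_smul, map_smul, h0, hπ, h1, smul_zero, smul_zero,
        zero_add, zero_add, smul_eq_mul, mul_one]
    intro hzero
    rw [hφℓ] at hzero
    apply ℓ₀_not_mem_span_one_pi
    rw [Submodule.mem_span_range_iff_exists_fun]
    refine ⟨![cf 0, cf 1], ?_⟩
    rw [Fin.sum_univ_two]
    simp only [Matrix.cons_val_zero, Matrix.cons_val_one]
    rw [← hcf, hzero, zero_smul, add_zero]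
  · have hli : LinearIndependent A ![ℓ₀, (1 : ℝ), Real.pi, Real.pi ^ 2] := by
      show LinearIndependent A (Fin.cons ℓ₀ ![(1 : ℝ), Real.pi, Real.pi ^ 2])
      exact linearIndependent_finCons.mpr ⟨hli3, hmem⟩
    obtain ⟨φ, hφ⟩ := exists_functional hli ![1, 0, 0, 1]
    refine ⟨φ, by simpa using hφ 1, by simpa using hφ 3, ?_, by simpa using hφ 2⟩
    have : φ ℓ₀ = 1 := by simpa using hφ 0
    rw [this]
    exact one_ne_zero

/-- The chosen functional of `E₂`. [folklore] -/
def φ₂ : ℝ →ₗ[A] A := Classical.choose exists_phi_piSq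

/-- `φ₂ 1 = 0`, `φ₂ (π²) = 1`, `φ₂ (log 2) ≠ 0`, `φ₂ π = 0`. [folklore] -/
theorem φ₂_spec : φ₂ 1 = 0 ∧ φ₂ (Real.pi ^ 2) = 1 ∧ φ₂ ℓ₀ ≠ 0 ∧ φ₂ Real.pi = 0 :=
  Classical.choose_spec exists_phi_piSq

/-- The shear `(φ₂, u = π², ℓ = log 2)`: `θ₂ = id + (φ₂∘Re + iφ₂∘Im)·(log 2 − π²)` moves
`π² ↦ log 2` and fixes `ℚ̄ ⊕ ℚ̄π` pointwise. [folklore] -/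
def S₂ : Shear := ⟨φ₂, Real.pi ^ 2, ℓ₀, φ₂_spec.1, φ₂_spec.2.1, φ₂_spec.2.2.1⟩

/-- The model `E₂ = exp ∘ θ₂`. [folklore] -/
def E₂ : ℂ → ℂ := S₂.E

/-- `E₂ = S₂.E`. [folklore] -/
theorem E₂_def : E₂ = S₂.E := rfl

/-- `φ₂` kills `π`. [folklore] -/
theorem S₂_φ_pi : S₂.φ Real.pi = 0 := φ₂_spec.2.2.2

/-- `u = π²`. [folklore] -/
theorem S₂_u : S₂.u = Real.pi ^ 2 := rfl

/-- `ℓ = log 2`. [folklore] -/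
theorem S₂_ℓ : S₂.ℓ = Real.log (2 : ℕ) := by
  show ℓ₀ = Real.log ((2 : ℕ) : ℝ)
  rw [Nat.cast_ofNat]
  rfl

/-- `d = log 2 − π² ≠ 0`. [folklore] -/
theorem S₂_d_ne_zero : S₂.d ≠ 0 := by
  show ℓ₀ - Real.pi ^ 2 ≠ 0
  have h3 := ℓ₀_lt
  have hπ := Real.pi_gt_three
  norm_num at h3
  nlinarith

/-- (P1) `ker E₂ = 2πiℤ`. [folklore] -/
theorem trueKernel_E₂ : TrueKernel E₂ := trueKernel_of S₂ S₂_φ_pi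

/-- (P2) `E₂ = exp` on `ℚ̄ ⊕ ℚ̄π`. [folklore] -/
theorem agreesOnPeriodPlane_E₂ : AgreesOnPeriodPlane E₂ := agreesOnPeriodPlane_of S₂ S₂_φ_pi

/-- `E₂ π = e^π`. [folklore] -/
theorem E₂_pi : E₂ Real.pi = cexp Real.pi := E_pi_of S₂ S₂_φ_pi

/-- `E₂ (iπ) = -1`. [folklore] -/
theorem E₂_pi_mul_I : E₂ ((Real.pi : ℂ) * I) = -1 := E_pi_mul_I_of S₂ S₂_φ_pi

/-- `E₂ (π²) = 2`. [folklore] -/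
theorem E₂_piSq : E₂ ((Real.pi : ℂ) ^ 2) = 2 := by
  show S₂.E ((Real.pi : ℂ) ^ 2) = 2
  rw [← Complex.ofReal_pow]
  exact (E_u_of_log S₂ (p := 2) two_pos S₂_ℓ).trans (by norm_num)

/-- `E₂ (iπ²) = 2^i = w₀`. [folklore] -/
theorem E₂_piSq_mul_I : E₂ ((Real.pi : ℂ) ^ 2 * I) = w₀ := by
  show S₂.E ((Real.pi : ℂ) ^ 2 * I) = w₀
  rw [← Complex.ofReal_pow]
  exact E_u_mul_I S₂

/-- `E₂ (π²) = 2 ≠ e^{π²}`: `E₂ ≠ exp` at `π²` (the cell `trdeg ℚ(π, e^{π²}) = 2` of `exp`, killed by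
`E₂`, is open). [folklore] -/
theorem E₂_piSq_ne_exp : E₂ ((Real.pi : ℂ) ^ 2) ≠ cexp ((Real.pi : ℂ) ^ 2) := by
  rw [E₂_piSq, ← Complex.ofReal_pow, ← Complex.ofReal_exp]
  intro h
  have h' : (2 : ℝ) = Real.exp (Real.pi ^ 2) := by exact_mod_cast h
  have h1 := Real.add_one_le_exp (Real.pi ^ 2)
  have h2 := Real.pi_gt_three
  nlinarith

/-- `E₂` is discontinuous on the real axis. [folklore] -/
theorem not_continuous_E₂_real : ¬ Continuous fun x : ℝ => E₂ x :=
  S₂.not_continuous_E_ofReal S₂_d_ne_zero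

/-- `E₂` is discontinuous. [folklore] -/
theorem not_continuous_E₂ : ¬ Continuous E₂ := S₂.not_continuous_E S₂_d_ne_zero

/-- `E₂` is not Borel-measurable on the real axis. [folklore] -/
theorem not_measurable_E₂_real : ¬ Measurable fun x : ℝ => E₂ x :=
  not_measurable_E_ofReal S₂ S₂_d_ne_zero

/-- `E₂` is not Borel-measurable. [folklore] -/
theorem not_measurable_E₂ : ¬ Measurable E₂ := not_measurable_E S₂ S₂_d_ne_zero

/-- `E₂` has the transcendence package (E1)–(E4). [folklore] -/
theorem transcendencePackage_E₂ : TranscendencePackage E₂ := transcendencePackage_shear S₂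

/-- (P3) Nesterenko verbatim for `E₂`. [cite: Nesterenko1996SbMath, Theorem 1 and its corollaries] -/
theorem nesterenkoE_E₂ (hN : nesterenko) : NesterenkoE E₂ := nesterenkoE_of S₂ hN S₂_φ_pi

/-- `E₂` has the PERIOD PACKAGE (granted Nesterenko). [cite: Nesterenko1996SbMath, Theorem 1 and its corollaries] -/
theorem periodPackage_E₂ (hN : nesterenko) : PeriodPackage E₂ := periodPackage_of S₂ hN S₂_φ_pi

/-- (E4) `S_{E₂}(1)`. [folklore] -/
theorem schanuelRankE_E₂_one : SchanuelRankE E₂ 1 := schanuelRankE_shear_one S₂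

/-- **`S_{E₂}(2)` FAILS** at the `ℚ`-free, conjugation-stable pair `(iπ, π²)`
(`trdeg ℚ(iπ, π², -1, 2) = 1 < 2`); with `schanuelRankE_E₂_one` this is a FIRST failure.
[folklore] -/
theorem not_schanuelRankE_E₂_two : ¬ SchanuelRankE E₂ 2 :=
  not_schanuelRankE_two_of S₂ (p := 2) two_pos S₂_φ_pi S₂_u S₂_ℓ

/-- **`X_{E₂}(2)` FAILS** at `r = (π, π²)` (`trdeg ℚ(π, π², iπ, iπ², e^π, 2, -1, 2^i) ≤ 3 < 4`).
[folklore] -/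
theorem not_kleinPolarE_E₂ : ¬ KleinPolarE E₂ :=
  not_kleinPolarE_of S₂ (k := 2) (by decide) two_pos S₂_φ_pi S₂_u S₂_ℓ

/-- **The summit text FAILS for `E₂`.** [folklore] -/
theorem not_schanuelE_E₂ : ¬ SchanuelE E₂ := fun h => not_schanuelRankE_E₂_two (h 2)

/-- The LENGTH-ONE Klein-polar cell at `r = (π)` HOLDS for `E₂` (Nesterenko).
[cite: Nesterenko1996SbMath, Theorem 1 and its corollaries] -/
theorem kleinPolar_pi_cell_E₂ (hN : nesterenko) : ((1 + 1 : ℕ) : Cardinal) ≤ Algebra.trdeg ℚ ↥(IntermediateField.adjoin ℚ (Set.range (Fin.append (fun j => (((![Real.pi] : Fin 1 → ℝ) j : ℝ) : ℂ)) (fun j => (((![Real.pi] : Fin 1 → ℝ) j : ℝ) : ℂ) * Complex.I)) ∪ Set.range (E₂ ∘ Fin.append (fun j => (((![Real.pi] : Fin 1 → ℝ) j : ℝ) : ℂ)) (fun j => (((![Real.pi] : Fin 1 → ℝ) j : ℝ) : ℂ) * Complex.I)))) :=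
  kleinPolar_pi_cell_of S₂ hN S₂_φ_pi

end Summit.Schanuel.Schanuel.Theorems.RootDecomp1BFinitePinningFloor

end
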